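import Summits.HubbardSuperconductivity.HubbardSuperconductivity.Theorems.NodalDiracTwistDiskTrivialHolonomyCore

/-!
# Route `NodalDiracTwist` — crux `NodalDiracWeakCoupling`: the annulus lemma, engine room

Helper file for stmt-HubbardSuperconductivity-10370 (`NodalDiracWeakCoupling`), supporting the
stub `stub_annulusInvariance` of the line `birth` (homotopy invariance of the `ℤ₂` holonomy of the
real ground-state bundle across a closed annulus on which the sector ground state is unique), the
ANNULUS twin of the disk theorem `re_prod_cyclicOverlap_pos`
(`NodalDiracTwistDiskTrivialHolonomyCore`). This file holds the ingredients that the disk proof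
had inlined or specialised to the disk, in the abstract setting of a finite index type `ι`, a
sector `K ≤ (ι → ℂ)` and a continuous family of matrices `H φ` (`φ ∈ ℝ²`):
* `uniform_overlap_of_isCompact` — uniform overlap of nearby unit sector ground states over a
  general COMPACT base set (the proof of `uniform_overlap` verbatim: the ground-state graph
  `isClosed_groundStateGraph` over `D` is compact inside `D × {unit sphere}`);
* the geometry of the shifted polar grid `p + (r₁ + (k/m)(r₂ - r₁)) (cos 2πj/n, sin 2πj/n)` of
  the annulus `r₁ ≤ |φ - p| ≤ r₂` (sup-metric distances, membership);
* `exists_unit_groundState_fixed` — `T`-real unit ground states for an antiunitary symmetry `T`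
  where the ground state is unique (Hatsugai, J. Phys. Soc. Jpn. 75 (2006) 123601);
* `prod_cells_eq` — the ladder identity `∏ cells = C_u C_w R²` of lattice link variables
  (Fukui–Hatsugai–Suzuki, J. Phys. Soc. Jpn. 74 (2005) 1674) and the resulting sign transport
  `neg_of_ladder`.
No new definitions.
-/

-- the mandated namespace `Summit.<Summit>.<Problem>.Theorems` repeats `HubbardSuperconductivity`
-- (single-problem summit, D-0017), which the `dupNamespace` linter flags on every declaration
set_option linter.dupNamespace false

namespace Summit.HubbardSuperconductivity.HubbardSuperconductivity.Theorems.NodalDiracTwist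

open Matrix Complex
open scoped ComplexOrder

/-! ### Uniform overlap over a compact base set -/

/-- **Uniform overlap of sector ground states over a compact base set.** Let `H` be a continuous
family of matrices whose sector energy on `K` obeys the variational lower bound, and suppose the
sector ground state is unique up to scalars at every point of the compact set `D ⊆ ℝ²`. Then for
every `ε > 0` there is `δ > 0` such that unit sector ground states at points of `D` at
(sup-)distance `< δ` have `|⟨χ, χ'⟩|² > 1 - ε` (the proof of `uniform_overlap`, with the closed
ground-state graph `isClosed_groundStateGraph` over `D` compact inside `D × {unit sphere}`).
Kato, *Perturbation Theory for Linear Operators* (1966), II §5.1 is the analytic prototype.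
[folklore] -/
theorem uniform_overlap_of_isCompact : ∀ {ι : Type*} [Fintype ι] (K : Submodule ℂ (ι → ℂ))
    (H : (Fin 2 → ℝ) → Matrix ι ι ℂ), Continuous H → ∀ {D : Set (Fin 2 → ℝ)}, IsCompact D →
    (∀ φ, ∀ v ∈ K, star v ⬝ᵥ v = 1 → (H φ).minEnergyOn K ≤ (star v ⬝ᵥ H φ *ᵥ v).re) →
    (∀ φ ∈ D, ∀ χ₁ χ₂ : ι → ℂ,
      (χ₁ ∈ K ∧ χ₁ ≠ 0 ∧ H φ *ᵥ χ₁ = (((H φ).minEnergyOn K : ℝ) : ℂ) • χ₁) →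
      (χ₂ ∈ K ∧ χ₂ ≠ 0 ∧ H φ *ᵥ χ₂ = (((H φ).minEnergyOn K : ℝ) : ℂ) • χ₂) →
      ∃ z : ℂ, χ₂ = z • χ₁) →
    ∀ {ε : ℝ}, 0 < ε →
    ∃ δ : ℝ, 0 < δ ∧ ∀ φ ∈ D, ∀ φ' ∈ D, dist φ φ' < δ → ∀ χ χ' : ι → ℂ,
      (χ ∈ K ∧ χ ≠ 0 ∧ H φ *ᵥ χ = (((H φ).minEnergyOn K : ℝ) : ℂ) • χ) → star χ ⬝ᵥ χ = 1 →
      (χ' ∈ K ∧ χ' ≠ 0 ∧ H φ' *ᵥ χ' = (((H φ').minEnergyOn K : ℝ) : ℂ) • χ') →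
      star χ' ⬝ᵥ χ' = 1 →
      1 - ε < ‖star χ ⬝ᵥ χ'‖ ^ 2 := by
  intro ι _ K H hH D hD hlb huniq ε hε
  classical
  -- the compact ground-state graph over `D`
  set G := {x : (Fin 2 → ℝ) × (ι → ℂ) | x.1 ∈ D ∧ x.2 ∈ K ∧ star x.2 ⬝ᵥ x.2 = 1 ∧
      H x.1 *ᵥ x.2 = (((star x.2 ⬝ᵥ H x.1 *ᵥ x.2).re : ℝ) : ℂ) • x.2 ∧
      ∀ ξ ∈ K, star ξ ⬝ᵥ ξ = 1 →
        (star x.2 ⬝ᵥ H x.1 *ᵥ x.2).re ≤ (star ξ ⬝ᵥ H x.1 *ᵥ ξ).re} with hG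
  have hGc : IsCompact G :=
    (hD.prod isCompact_unitSphere).of_isClosed_subset
      (isClosed_groundStateGraph K H hH hD.isClosed) fun _ hx => ⟨hx.1, hx.2.2.1⟩
  have hmemG : ∀ (φ : Fin 2 → ℝ) (χ : ι → ℂ), φ ∈ D →
      (χ ∈ K ∧ χ ≠ 0 ∧ H φ *ᵥ χ = (((H φ).minEnergyOn K : ℝ) : ℂ) • χ) → star χ ⬝ᵥ χ = 1 →
      (φ, χ) ∈ G := fun φ χ hφ hχ h1 =>
    ⟨hφ, hχ.1, h1, minimal_of_mulVec_eq_minEnergyOn_smul K (hlb φ) hχ.2.2 h1⟩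
  have hGS : ∀ x ∈ G,
      x.2 ∈ K ∧ x.2 ≠ 0 ∧ H x.1 *ᵥ x.2 = (((H x.1).minEnergyOn K : ℝ) : ℂ) • x.2 :=
    fun x hx => ⟨hx.2.1, ne_zero_of_unit hx.2.2.1,
      mulVec_eq_minEnergyOn_smul_of_minimal K hx.2.1 hx.2.2.1 hx.2.2.2.1 hx.2.2.2.2⟩
  -- the overlap and the base-point distance on `G × G`
  set f : ((Fin 2 → ℝ) × (ι → ℂ)) × ((Fin 2 → ℝ) × (ι → ℂ)) → ℝ :=
    fun z => ‖star z.1.2 ⬝ᵥ z.2.2‖ ^ 2 with hf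
  have hfc : Continuous f := by
    simp only [hf]
    fun_prop
  set g : ((Fin 2 → ℝ) × (ι → ℂ)) × ((Fin 2 → ℝ) × (ι → ℂ)) → ℝ :=
    fun z => dist z.1.1 z.2.1 with hg
  have hgc : Continuous g := by
    simp only [hg]
    fun_prop
  set B := (G ×ˢ G) ∩ {z | f z ≤ 1 - ε} with hB
  have hBc : IsCompact B := (hGc.prod hGc).inter_right (isClosed_le hfc continuous_const)
  -- on `B` the base points differ (uniqueness of the ground state at a common base point)
  have hpos : ∀ z ∈ B, 0 < g z := by
    rintro ⟨⟨φ, χ⟩, ⟨φ', χ'⟩⟩ ⟨⟨hx, hy⟩, hfz⟩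
    change 0 < dist φ φ'
    refine dist_pos.2 fun hφφ' => ?_
    subst hφφ'
    obtain ⟨z, hz⟩ := huniq φ hx.1 χ χ' (hGS _ hx) (hGS _ hy)
    have h1 : star χ ⬝ᵥ χ = 1 := hx.2.2.1
    have h1' : star χ' ⬝ᵥ χ' = 1 := hy.2.2.1
    rw [hz] at h1'
    have hz1 : ‖z‖ = 1 := norm_eq_one_of_unit_smul h1 h1'
    have hfz1 : f ((φ, χ), (φ, χ')) = 1 := by
      change ‖star χ ⬝ᵥ χ'‖ ^ 2 = 1
      rw [hz, dotProduct_smul, h1, smul_eq_mul, mul_one, hz1, one_pow]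
    have hfz' : f ((φ, χ), (φ, χ')) ≤ 1 - ε := hfz
    linarith
  by_cases hBne : B.Nonempty
  · obtain ⟨z₀, hz₀, hmin⟩ := hBc.exists_isMinOn hBne hgc.continuousOn
    refine ⟨g z₀, hpos z₀ hz₀, ?_⟩
    intro φ hφ φ' hφ' hd χ χ' hχ h1 hχ' h1'
    by_contra hlt
    have hzB : ((φ, χ), (φ', χ')) ∈ B :=
      ⟨⟨hmemG φ χ hφ hχ h1, hmemG φ' χ' hφ' hχ' h1'⟩, not_lt.1 hlt⟩
    have hle := (isMinOn_iff.1 hmin) _ hzB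
    exact absurd hle (not_le.2 hd)
  · refine ⟨1, one_pos, ?_⟩
    intro φ hφ φ' hφ' _ χ χ' hχ h1 hχ' h1'
    by_contra hlt
    exact hBne ⟨((φ, χ), (φ', χ')), ⟨hmemG φ χ hφ hχ h1, hmemG φ' χ' hφ' hχ' h1'⟩, not_lt.1 hlt⟩

/-! ### The shifted polar grid of an annulus: points, distances -/

/-- `|ρ (cos θ, sin θ)|² = ρ²` for the `Fin 2 → ℝ` point `p + ρ (cos θ, sin θ)` written with the
`if` of the route statements. [folklore] -/
theorem polar_sq_eq (p : Fin 2 → ℝ) (ρ θ : ℝ) :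
    ((fun ν : Fin 2 => p ν + ρ * (if ν = 0 then Real.cos θ else Real.sin θ)) 0 - p 0) ^ 2 +
      ((fun ν : Fin 2 => p ν + ρ * (if ν = 0 then Real.cos θ else Real.sin θ)) 1 - p 1) ^ 2 =
      ρ ^ 2 := by
  simp only [if_true, show (1 : Fin 2) ≠ 0 by decide, if_false, add_sub_cancel_left]
  calc (ρ * Real.cos θ) ^ 2 + (ρ * Real.sin θ) ^ 2 = ρ ^ 2 * (Real.cos θ ^ 2 + Real.sin θ ^ 2) := by
        ring
    _ = ρ ^ 2 := by rw [Real.cos_sq_add_sin_sq, mul_one]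

/-- Sup-metric distance of two points `p + ρ (cos θ, sin θ)`, `p + ρ' (cos θ', sin θ')` with
`0 ≤ ρ ≤ R`: at most `R |θ - θ'| + |ρ - ρ'|` (`cos`, `sin` are `1`-Lipschitz and bounded by `1`).
[folklore] -/
theorem dist_polar_le (p : Fin 2 → ℝ) {ρ R : ℝ} (hρ : 0 ≤ ρ) (hρR : ρ ≤ R) (ρ' θ θ' : ℝ) :
    dist (fun ν : Fin 2 => p ν + ρ * (if ν = 0 then Real.cos θ else Real.sin θ))
      (fun ν : Fin 2 => p ν + ρ' * (if ν = 0 then Real.cos θ' else Real.sin θ')) ≤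
      R * |θ - θ'| + |ρ - ρ'| := by
  have hR : 0 ≤ R := hρ.trans hρR
  rw [dist_pi_le_iff (by positivity)]
  intro ν
  rw [Real.dist_eq]
  -- the two trigonometric components, uniformly
  have key : ∀ f : ℝ → ℝ, (∀ x y, |f x - f y| ≤ |x - y|) → (∀ x, |f x| ≤ 1) →
      |p ν + ρ * f θ - (p ν + ρ' * f θ')| ≤ R * |θ - θ'| + |ρ - ρ'| := by
    intro f hlip hbd
    have hsplit : p ν + ρ * f θ - (p ν + ρ' * f θ') = ρ * (f θ - f θ') + (ρ - ρ') * f θ' := by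
      ring
    rw [hsplit]
    refine (abs_add_le _ _).trans (add_le_add ?_ ?_)
    · rw [abs_mul, abs_of_nonneg hρ]
      exact mul_le_mul hρR (hlip θ θ') (abs_nonneg _) hR
    · rw [abs_mul]
      calc |ρ - ρ'| * |f θ'| ≤ |ρ - ρ'| * 1 := by
            gcongr
            exact hbd θ'
        _ = |ρ - ρ'| := mul_one _
  fin_cases ν
  · simpa using key Real.cos Real.abs_cos_sub_cos_le Real.abs_cos_le_one
  · simpa using key Real.sin Real.abs_sin_sub_sin_le Real.abs_sin_le_one

/-- The radii `ρ_k = r₁ + (k/m)(r₂ - r₁)`, `k ≤ m`, of the shifted polar grid of the annulus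
`r₁ ≤ |φ - p| ≤ r₂` lie in `[r₁, r₂]`. [folklore] -/
theorem annulusRadius_mem {r₁ r₂ : ℝ} (hr₁₂ : r₁ ≤ r₂) {m : ℕ} (hm : 0 < m) {k : ℕ}
    (hk : k ≤ m) :
    r₁ ≤ r₁ + (k : ℝ) / m * (r₂ - r₁) ∧ r₁ + (k : ℝ) / m * (r₂ - r₁) ≤ r₂ := by
  have hm' : (0 : ℝ) < m := by exact_mod_cast hm
  have hkm : (k : ℝ) / m ≤ 1 := (div_le_one hm').2 (by exact_mod_cast hk)
  have hkm0 : 0 ≤ (k : ℝ) / m := by positivity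
  constructor <;> nlinarith

/-- Distance estimate on the shifted polar grid `v_{k,j} = p + ρ_k (cos θ_j, sin θ_j)`,
`ρ_k = r₁ + (k/m)(r₂ - r₁)`, `θ_j = 2πj/n`, of the annulus `r₁ ≤ |φ - p| ≤ r₂` (`0 ≤ r₁ ≤ r₂`),
in the sup metric of `Fin 2 → ℝ`: for `k ≤ m`,
`dist(v_{k,j}, v_{k',j'}) ≤ r₂ |θ_j - θ_{j'}| + |k/m - k'/m| (r₂ - r₁)`. [folklore] -/
theorem dist_annulusGrid_le (p : Fin 2 → ℝ) {r₁ r₂ : ℝ} (hr₁ : 0 ≤ r₁) (hr₁₂ : r₁ ≤ r₂) {m : ℕ}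
    (hm : 0 < m) (n : ℕ) {k : ℕ} (hk : k ≤ m) (k' j j' : ℕ) :
    dist (fun ν : Fin 2 => p ν + (r₁ + (k : ℝ) / m * (r₂ - r₁)) *
        (if ν = 0 then Real.cos (2 * Real.pi * (j : ℝ) / n)
          else Real.sin (2 * Real.pi * (j : ℝ) / n)))
      (fun ν : Fin 2 => p ν + (r₁ + (k' : ℝ) / m * (r₂ - r₁)) *
        (if ν = 0 then Real.cos (2 * Real.pi * (j' : ℝ) / n)
          else Real.sin (2 * Real.pi * (j' : ℝ) / n))) ≤
      r₂ * |2 * Real.pi * (j : ℝ) / n - 2 * Real.pi * (j' : ℝ) / n| +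
        |(k : ℝ) / m - (k' : ℝ) / m| * (r₂ - r₁) := by
  obtain ⟨h1, h2⟩ := annulusRadius_mem hr₁₂ hm hk
  refine (dist_polar_le p (hr₁.trans h1) h2 _ _ _).trans (le_of_eq ?_)
  rw [show r₁ + (k : ℝ) / m * (r₂ - r₁) - (r₁ + (k' : ℝ) / m * (r₂ - r₁)) =
      ((k : ℝ) / m - (k' : ℝ) / m) * (r₂ - r₁) by ring, abs_mul,
    abs_of_nonneg (sub_nonneg.2 hr₁₂)]

/-- The shifted polar grid point `v_{k,j}` (`k ≤ m`) lies in the closed annulus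
`r₁² ≤ |φ - p|² ≤ r₂²` (`0 ≤ r₁ ≤ r₂`). [folklore] -/
theorem annulusGrid_mem (p : Fin 2 → ℝ) {r₁ r₂ : ℝ} (hr₁ : 0 ≤ r₁) (hr₁₂ : r₁ ≤ r₂) {m : ℕ}
    (hm : 0 < m) (n : ℕ) {k : ℕ} (hk : k ≤ m) (j : ℕ) :
    r₁ ^ 2 ≤ ((fun ν : Fin 2 => p ν + (r₁ + (k : ℝ) / m * (r₂ - r₁)) *
        (if ν = 0 then Real.cos (2 * Real.pi * (j : ℝ) / n)
          else Real.sin (2 * Real.pi * (j : ℝ) / n))) 0 - p 0) ^ 2 +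
      ((fun ν : Fin 2 => p ν + (r₁ + (k : ℝ) / m * (r₂ - r₁)) *
        (if ν = 0 then Real.cos (2 * Real.pi * (j : ℝ) / n)
          else Real.sin (2 * Real.pi * (j : ℝ) / n))) 1 - p 1) ^ 2 ∧
    ((fun ν : Fin 2 => p ν + (r₁ + (k : ℝ) / m * (r₂ - r₁)) *
        (if ν = 0 then Real.cos (2 * Real.pi * (j : ℝ) / n)
          else Real.sin (2 * Real.pi * (j : ℝ) / n))) 0 - p 0) ^ 2 +
      ((fun ν : Fin 2 => p ν + (r₁ + (k : ℝ) / m * (r₂ - r₁)) *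
        (if ν = 0 then Real.cos (2 * Real.pi * (j : ℝ) / n)
          else Real.sin (2 * Real.pi * (j : ℝ) / n))) 1 - p 1) ^ 2 ≤ r₂ ^ 2 := by
  obtain ⟨h1, h2⟩ := annulusRadius_mem hr₁₂ hm hk
  rw [polar_sq_eq]
  exact ⟨pow_le_pow_left₀ hr₁ h1 2, pow_le_pow_left₀ (hr₁.trans h1) h2 2⟩


/-! ### `T`-real unit ground states; cells; the ladder identity -/

/-- **`T`-real unit sector ground states.** If the sector ground state of `A` on `K` exists and
is unique up to scalars, and `T` is an antiunitary operation (`T (c v) = c̄ T v`,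
`⟨T u, T v⟩ = conj ⟨u, v⟩`) preserving `K` and commuting with `A`, then there is a unit sector
ground state `s` with `T s = s`: `T χ = z χ` with `|z| = 1` for any unit ground state `χ`, and
`s = √z χ` works. Hatsugai, J. Phys. Soc. Jpn. 75 (2006) 123601 (real gauge under an antiunitary
symmetry). [folklore] -/
theorem exists_unit_groundState_fixed {ι : Type*} [Fintype ι] (K : Submodule ℂ (ι → ℂ))
    (A : Matrix ι ι ℂ)
    (hex : ∃ v ∈ K, v ≠ 0 ∧ A *ᵥ v = ((A.minEnergyOn K : ℝ) : ℂ) • v)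
    (T : (ι → ℂ) → (ι → ℂ)) (hTs : ∀ (c : ℂ) (v : ι → ℂ), T (c • v) = star c • T v)
    (hTK : ∀ v ∈ K, T v ∈ K) (hTH : ∀ v, T (A *ᵥ v) = A *ᵥ T v)
    (hTd : ∀ u v, star (T u) ⬝ᵥ T v = star (star u ⬝ᵥ v))
    (huniq : ∀ χ₁ χ₂ : ι → ℂ, (χ₁ ∈ K ∧ χ₁ ≠ 0 ∧ A *ᵥ χ₁ = ((A.minEnergyOn K : ℝ) : ℂ) • χ₁) →
      (χ₂ ∈ K ∧ χ₂ ≠ 0 ∧ A *ᵥ χ₂ = ((A.minEnergyOn K : ℝ) : ℂ) • χ₂) → ∃ z : ℂ, χ₂ = z • χ₁) :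
    ∃ s : ι → ℂ, (s ∈ K ∧ s ≠ 0 ∧ A *ᵥ s = ((A.minEnergyOn K : ℝ) : ℂ) • s) ∧
      star s ⬝ᵥ s = 1 ∧ T s = s := by
  have hT0 : ∀ χ : ι → ℂ, χ ≠ 0 → T χ ≠ 0 := by
    intro χ hχ hT
    apply hχ
    have h := hTd χ χ
    rw [hT, star_zero, zero_dotProduct] at h
    exact dotProduct_star_self_eq_zero.1 (star_eq_zero.1 h.symm)
  have hTGS : ∀ χ, (χ ∈ K ∧ χ ≠ 0 ∧ A *ᵥ χ = ((A.minEnergyOn K : ℝ) : ℂ) • χ) →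
      (T χ ∈ K ∧ T χ ≠ 0 ∧ A *ᵥ T χ = ((A.minEnergyOn K : ℝ) : ℂ) • T χ) := by
    rintro χ ⟨hK, h0, hHχ⟩
    refine ⟨hTK χ hK, hT0 χ h0, ?_⟩
    rw [← hTH, hHχ, hTs, Complex.star_def, Complex.conj_ofReal]
  have hsmul : ∀ χ (c : ℂ), c ≠ 0 → (χ ∈ K ∧ χ ≠ 0 ∧ A *ᵥ χ = ((A.minEnergyOn K : ℝ) : ℂ) • χ) →
      (c • χ ∈ K ∧ c • χ ≠ 0 ∧ A *ᵥ (c • χ) = ((A.minEnergyOn K : ℝ) : ℂ) • (c • χ)) := by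
    rintro χ c hc ⟨hK, h0, hHχ⟩
    exact ⟨K.smul_mem c hK, smul_ne_zero hc h0, by rw [mulVec_smul, hHχ, smul_comm]⟩
  obtain ⟨v, hvK, hv0, hv⟩ := hex
  obtain ⟨c, hc0, hc1⟩ := Literature.MathematicalPhysics.QuantumLattice.exists_smul_unit hv0
  have hχ := hsmul v c hc0 ⟨hvK, hv0, hv⟩
  obtain ⟨z, hz⟩ := huniq (c • v) (T (c • v)) hχ (hTGS _ hχ)
  have hT1 : star (T (c • v)) ⬝ᵥ T (c • v) = 1 := by rw [hTd, hc1, star_one]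
  rw [hz] at hT1
  have hz1 : ‖z‖ = 1 := norm_eq_one_of_unit_smul hc1 hT1
  obtain ⟨w, hw⟩ := IsAlgClosed.exists_pow_nat_eq z two_pos
  have hw1 : ‖w‖ = 1 := by
    have h := congrArg norm hw
    rw [norm_pow, hz1] at h
    exact (pow_eq_one_iff_of_nonneg (norm_nonneg w) two_ne_zero).1 h
  have hw0 : w ≠ 0 := fun h => by
    rw [h, norm_zero] at hw1
    exact zero_ne_one hw1
  refine ⟨w • (c • v), hsmul _ w hw0 hχ, ?_, ?_⟩
  · rw [star_smul_dotProduct_smul, hc1, hw1, one_pow, Complex.ofReal_one, one_mul]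
  · rw [hTs, hz, smul_smul, ← hw]
    congr 1
    calc star w * w ^ 2 = (starRingEnd ℂ w * w) * w := by rw [Complex.star_def]; ring
      _ = w := by rw [Complex.conj_mul', hw1, Complex.ofReal_one, one_pow, one_mul]

/-- **The ladder identity.** For a symmetric real link function `Lk` and two sequences of points
`u`, `w` which are `n`-periodic in the sense of `finRotate` (two consecutive circles of a polar
grid), the product of the link products around the `n` cells between them equals `C_u C_w R²`:
`C_u`, `C_w` the loop products along `u`, `w`, and `R` the product of the radial links, each of
which occurs in two neighbouring cells. (Lattice Stokes theorem for link variables;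
Fukui–Hatsugai–Suzuki, J. Phys. Soc. Jpn. 74 (2005) 1674.) [folklore] -/
theorem prod_cells_eq {X : Type*} (Lk : X → X → ℝ) (hLsymm : ∀ a b, Lk b a = Lk a b) {n : ℕ}
    (u w : ℕ → X) (hu : ∀ i : Fin n, u (finRotate n i) = u ((i : ℕ) + 1))
    (hw : ∀ i : Fin n, w (finRotate n i) = w ((i : ℕ) + 1)) :
    ∏ i : Fin n, Lk (u i) (u ((i : ℕ) + 1)) * Lk (u ((i : ℕ) + 1)) (w ((i : ℕ) + 1)) *
        Lk (w ((i : ℕ) + 1)) (w i) * Lk (w i) (u i) =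
      (∏ i : Fin n, Lk (u i) (u ((i : ℕ) + 1))) * (∏ i : Fin n, Lk (w i) (w ((i : ℕ) + 1))) *
        ((∏ i : Fin n, Lk (u i) (w i)) * ∏ i : Fin n, Lk (u i) (w i)) := by
  rw [Finset.prod_mul_distrib, Finset.prod_mul_distrib, Finset.prod_mul_distrib]
  have h2 : ∏ i : Fin n, Lk (u ((i : ℕ) + 1)) (w ((i : ℕ) + 1)) = ∏ i : Fin n, Lk (u i) (w i) := by
    have h : ∀ i : Fin n, Lk (u ((i : ℕ) + 1)) (w ((i : ℕ) + 1)) =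
        Lk (u (finRotate n i)) (w (finRotate n i)) := fun i => by rw [hu, hw]
    rw [Finset.prod_congr rfl fun i _ => h i]
    exact Equiv.prod_comp (finRotate n) (fun i : Fin n => Lk (u i) (w i))
  have h3 : ∏ i : Fin n, Lk (w ((i : ℕ) + 1)) (w i) = ∏ i : Fin n, Lk (w i) (w ((i : ℕ) + 1)) :=
    Finset.prod_congr rfl fun i _ => hLsymm _ _
  have h4 : ∏ i : Fin n, Lk (w i) (u i) = ∏ i : Fin n, Lk (u i) (w i) :=
    Finset.prod_congr rfl fun i _ => hLsymm _ _
  rw [h2, h3, h4]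
  ring

/-- **Sign transport along a ladder**: if consecutive terms of a real sequence `C` have positive
product up to `m` and `C 0 < 0`, then `C k < 0` for all `k ≤ m`. [folklore] -/
theorem neg_of_ladder {C : ℕ → ℝ} {m : ℕ} (hCC : ∀ k, k + 1 ≤ m → 0 < C k * C (k + 1))
    (hC0 : C 0 < 0) {k : ℕ} (hk : k ≤ m) : C k < 0 := by
  induction k with
  | zero => exact hC0
  | succ k ih => exact neg_of_mul_pos_right (hCC k hk) (ih (Nat.le_of_succ_le hk)).le

end Summit.HubbardSuperconductivity.HubbardSuperconductivity.Theorems.NodalDiracTwist
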